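import Summits.PneNP.PneNP.Theorems.LatticeMagicTargetIffProofcplxThesis
import Summits.PneNP.PneNP.Theorems.LatticeMagicTargetRemotePoint
import Summits.PneNP.PneNP.Theorems.ExpanderLinearGeneratorsNoPolyBoundedProofSystemExpTime
import Summits.PneNP.PneNP.Theorems.ProofCplxProofcplxGeneratorImpliesNPNeCoNP
import Literature.Algebra.EuclideanLattices.LatticeComplexityProofs
import Literature.Barriers.PneNP.RelativizationSparseTallyCoNP
import Literature.Barriers.PneNP.RelativizedCircuitSizeProofs
import Summits.PneNP.PneNP.Theorems.LatticeMagicTaylorMinorantsBuySqrtK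

/-!
# Strategy census for crux `Target` (stmt-PneNP-10709, route PneNP/LatticeMagic) — the typed attempts

Companion to `Cruxes/Target/STRATEGY-CENSUS.md` (crux-strategist `cstrat-stmt-PneNP-10709-p1`, wall-breaker
pass on the exhausted chain, 2026-08-17). Everything here is `sorry`-free and imports only LANDED modules.

The crux is X = `Summit.PneNP.PneNP.Theses.LatticeMagic.Target`
  = `∃ c ≥ 1, GapCVP_c ∉ PromiseCoNP` (far-from-the-lattice at constant factor has no p-bounded certificate system).

What is CHECKED here (section = heading of the census):

* §0 Read-back. `Target ↔ NP ≠ coNP ↔ ¬ HasPolyBoundedProofSystem TAUT` (tree, p101056 / p105441), `Target → PneNP`: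
  the crux sits AT OR ABOVE THE SUMMIT; `¬ Target ↔ NP = coNP ↔ ∀ c ≥ 1, GapCVP_c ∈ PromiseCoNP`; the constant `c`
  is immaterial (`targetAt_const_iff_target`: every constant factor `c > 1` gives the same statement).
* §T Transfer. The solved sibling OF EXACTLY THIS STATEMENT is the relativized one: `∃ C, NP^C ≠ coNP^C` is a tree
  theorem (Wilson 1985 Thm. 4 constructed, `Wilson1985_thm_4_holds`; Baker–Gill–Solovay-type hiding). The transfer
  breaks at ORACLE DENSITY, kernel-checked: by Long–Selman's tally theorem (tree) the same separation at a TALLY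
  oracle is not a sibling but the crux itself (`target_iff_exists_tally_separation`).
* §S Strengthen. Every strengthening S⁺ anyone has typed is placed above X by a proved arrow and none comes back:
  `co NE ≠ NE`, `co NEXP ≠ NEXP`, "no optimal proof system for TAUT", Krajíček's all-NP-hitting generator
  (route ProofCplx's crux stmt-PneNP-0111), `GapSVP_c ∉ PromiseCoNP` (p105366), the factor ladder `TargetAt γ`
  (any `γ ≥ 1`; FALSE at `γ = C√n`, Aharonov–Regev, tree), and the remote-point form (dead line `Sketch`).
* §D Decomposition. The optimality split, as a schema over an arbitrary proof system `V`:
  `target_of_optimalFor_of_not_isPolyBounded : pps V → OptimalFor V → ¬ IsPolyBounded V → Target` (glue PROVED),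
  `optimalFor_of_isPolyBounded` (so `OptimalFor V ∨ ¬ IsPolyBounded V` always: the two halves are never both
  refutable), and the costume certificate `target_iff_forall_optimalFor_imp_not_isPolyBounded` (the split with `V`
  left universally quantified IS the crux). The census explains why every INSTANCE straddles the lower-bound
  frontier (below it `¬ OptimalFor V` is a theorem, at `EF` and above `¬ IsPolyBounded V` is the EF problem).
* §N Negation. `¬ Target ↔ NP = coNP`; the counterexample exists at factor `C√n` (`not_targetAt_sqrt`) and the
  typed obstruction to pushing it down — blindness of every order-`K` Taylor-minorant certificate below `√(n/K)` —
  is the route's PROVED rung `TaylorMinorantsBuySqrtK` (stmt-PneNP-2329), a statement about one certificate CLASS,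
  which (meta-fact `latticeMagicTarget_line_closure_proves_NP_ne_coNP`) can be a stub of a closing line only
  together with a stub that is again `≥ NP ≠ coNP`.

Nothing in this file is a line skeleton: no `stub_*`, and no theorem concludes the crux from open obligations
(by design — the census verdict is `no-strategy-short-of-summit`; the crux is kernel-equivalent to `NP ≠ coNP`).
-/

set_option linter.dupNamespace false

namespace Summit.PneNP.PneNP.Cruxes.Target.StrategyCensus

open Literature.Computability.Complexity Literature.Computability.Complexity.Nondeterministic
open Literature.Computability.MetaComplexity Literature.Algebra.EuclideanLattices
open Literature.Barriers.PneNP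
open Summit.PneNP.PneNP.Theses.LatticeMagic (Target TaylorMinorantsBuySqrtK)
open Summit.PneNP.PneNP.Theorems

/-! ## §0 Read-back: the crux is `NP ≠ coNP`, hence at or above the summit -/

/-- `Target ↔ NP ≠ coNP` (tree theorem p101056, restated). [cite: AroraEtAl1997, Thm. 5 (i)] [cite: AharonovRegev2005, App. B] -/
theorem target_iff_NP_ne_coNP : Target ↔ NP ≠ coNP :=
  latticeMagicTarget_iff_NP_ne_coNP

/-- `Target ↔ ¬ HasPolyBoundedProofSystem TAUT` = item stmt-PneNP-0097 (tree theorem p105441, restated).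
[cite: CookReckhow1979, §1 Prop. 1.1] -/
theorem target_iff_noPolyBoundedProofSystem : Target ↔ ¬ HasPolyBoundedProofSystem TAUT :=
  latticeMagicTarget_iff_not_hasPolyBoundedProofSystem_TAUT

/-- The crux already proves the summit: `Target → PneNP` (tree). So every line for the crux is a line for a
statement at least as strong as the summit `PneNP` (indeed strictly stronger in the accepted picture:
`NP ≠ coNP ⟹ P ≠ NP`, converse unknown). [folklore] -/
theorem pneNP_of_target (h : Target) : _root_.PneNP :=
  pneNP_of_latticeMagicTarget h

/-- `¬ Target ↔ NP = coNP`. [folklore] -/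
theorem not_target_iff_NP_eq_coNP : ¬ Target ↔ NP = coNP := by
  rw [target_iff_NP_ne_coNP, not_not]

/-- `¬ Target` unfolded: EVERY constant factor `c ≥ 1` has a p-bounded certificate system for far-from-the-lattice.
[folklore] -/
theorem not_target_iff_forall_mem :
    ¬ Target ↔ ∀ c : ℝ, 1 ≤ c → gapCVPPromise (fun _ => c) ∈ PromiseCoNP := by
  unfold Target
  push Not
  rfl

/-- The factor ladder: `TargetAt γ` := "GapCVP_γ ∉ PromiseCoNP" for a factor function `γ`. [folklore] -/
def TargetAt (γ : ℕ → ℝ) : Prop :=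
  gapCVPPromise γ ∉ PromiseCoNP

/-- Every rung of the factor ladder with `γ ≥ 1` is ABOVE `NP ≠ coNP` (GapCVP_γ ∈ PromiseNP, Aharonov–Regev §1,
tree theorem `gapCVP_mem_promiseNP_holds`): raising the factor never makes the statement weaker than the crux.
[cite: AharonovRegev2005, §1 (p. 2)] -/
theorem NP_ne_coNP_of_targetAt {γ : ℕ → ℝ} (hγ : ∀ n, 1 ≤ γ n) (h : TargetAt γ) : NP ≠ coNP := by
  intro heq
  apply h
  have hNP : gapCVPPromise γ ∈ PromiseNP := gapCVP_mem_promiseNP_holds γ hγ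
  show gapCVPPromise γ ∈ promiseLift coNP
  rw [← heq]
  exact hNP

/-- Hence every rung `γ ≥ 1` implies the crux. [cite: AharonovRegev2005, §1 (p. 2)] [cite: AroraEtAl1997, Thm. 5 (i)] -/
theorem target_of_targetAt {γ : ℕ → ℝ} (hγ : ∀ n, 1 ≤ γ n) (h : TargetAt γ) : Target :=
  latticeMagicTarget_of_NP_ne_coNP (NP_ne_coNP_of_targetAt hγ h)

/-- The `∃ c` of the crux is immaterial: for every constant `c > 1` the single rung `TargetAt c` IS the crux
(GapCVP_c is NP-hard, Arora–Babai–Stern–Sweedyk, discharged in the tree). [cite: AroraEtAl1997, Thm. 5 (i)] -/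
theorem targetAt_const_iff_target {c : ℚ} (hc : 1 < c) : TargetAt (fun _ => (c : ℝ)) ↔ Target := by
  refine ⟨fun h => target_of_targetAt (fun _ => by exact_mod_cast hc.le) h, fun hT hco => ?_⟩
  have hne : NP ≠ coNP := target_iff_NP_ne_coNP.mp hT
  exact hne (np_eq_coNP_of_isNPHard_of_mem_PromiseCoNP hco (isNPHard_gapCVPPromise_const hc))

/-! ## §T Transfer: the relativized sibling is solved in the tree; the break point is oracle density -/

/-- The solved sibling of EXACTLY this statement: an oracle `C` with `NP^C ≠ coNP^C` (Wilson 1985 Thm. 4,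
constructed in the tree; the Baker–Gill–Solovay hiding argument: `{1ⁿ | C ∩ {0,1}ⁿ ≠ ∅} ∈ NP^C` has no
`NP^C` refutations because the adversary keeps `2ⁿ` unqueried strings free). [cite: Wilson1985, Thm. 4 (pp. 176–177)] -/
theorem sibling_relativized_separation :
    ∃ C : Language Bool, NPRel (Oracle.ofLanguage C) ≠ coNPRel (Oracle.ofLanguage C) := by
  obtain ⟨C, hC, -⟩ := Wilson1985_thm_4_holds
  exact ⟨C, hC⟩

/-- The break point, kernel-checked: the same separation at a TALLY oracle is not a sibling — it IS the crux
(Long–Selman 1986: `NP = coNP ↔ ∀ tally T, NP^T = coNP^T`, tree theorem `NP_ne_coNP_iff_exists_tally`).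
The sibling's proof needs `2ⁿ` hideable strings per length; a tally oracle offers one. [cite: LongSelman1986, main theorem (tally form)] -/
theorem target_iff_exists_tally_separation :
    Target ↔ ∃ T : Language Bool, IsTally T ∧ NPRel (Oracle.ofLanguage T) ≠ coNPRel (Oracle.ofLanguage T) :=
  target_iff_NP_ne_coNP.trans NP_ne_coNP_iff_exists_tally

/-! ## §S Strengthen: every typed S⁺ is placed above X; none buys structure for THIS step -/

/-- (S1) `co NE ≠ NE → Target` (downward separation by padding, tree). [cite: KrajicekProofComplexity2019, §21.1 (Cor. 21.1.3)] -/
theorem target_of_co_NE_ne_NE (h : co NE ≠ NE) : Target :=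
  latticeMagicTarget_iff_noPolyBoundedProofSystem.mpr (noPolyBoundedProofSystem_of_co_NE_ne_NE h)

/-- (S2) `co NEXP ≠ NEXP → Target`. [cite: AroraBarak2009, §2.6.2 (Thm. 2.22, padding)] -/
theorem target_of_co_NEXP_ne_NEXP (h : co NEXP ≠ NEXP) : Target :=
  latticeMagicTarget_iff_noPolyBoundedProofSystem.mpr (noPolyBoundedProofSystem_of_co_NEXP_ne_NEXP h)

/-- `OptimalFor V`: the proof system `V` simulates every proof system for `TAUT` (Krajíček–Pudlák optimality,
weak/length form). [cite: KrajicekProofComplexity2019, §1.5 (Problem 1.5.5) and §21.1] -/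
def OptimalFor (V : List Bool → List Bool → Bool) : Prop :=
  ∀ W : List Bool → List Bool → Bool, IsProofSystemFor W TAUT → Simulates V W

/-- (S3) "TAUT has no optimal proof system" `→ Target` (a p-bounded system would be optimal; tree).
Above the crux: it even gives `NE ≠ coNE` (Cor. 21.1.3), and Messner: no coNE-hard set has optimal proof systems.
[cite: KrajicekProofComplexity2019, §21.1 (before Cor. 21.1.3)] -/
theorem target_of_no_optimal (h : ¬ ∃ V, IsProofSystemFor V TAUT ∧ OptimalFor V) : Target :=
  latticeMagicTarget_iff_noPolyBoundedProofSystem.mpr (noPolyBoundedProofSystem_of_no_optimal h)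

/-- (S4) Krajíček's generator hitting every infinite NP set (route ProofCplx crux stmt-PneNP-0111) `→ Target`,
through the PROVED support stmt-PneNP-0114. [cite: Krajicek2022Generators, arXiv:2208.11642 §1 (p. 4)] -/
theorem target_of_krajicekGenerator (h : Summit.PneNP.PneNP.Theses.ProofCplx.ProofcplxKrajicekGenerator) :
    Target :=
  latticeMagicTarget_of_NP_ne_coNP (proofcplx_generatorImpliesNPNeCoNP_proof h)

/-- (S5) The homogeneous strengthening `GapSVP_c ∉ PromiseCoNP → Target` (landed p105366, restated).
[cite: AharonovRegev2005, App. A (Lemma A.1)] -/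
theorem target_of_gapSVP (h : ∃ c : ℝ, 1 ≤ c ∧ gapSVPPromise (fun _ => c) ∉ PromiseCoNP) : Target :=
  latticeMagicTarget_of_gapSVP_not_mem_promiseCoNP h

/-! ## §D Decomposition: the optimality split as a schema, its glue proved, and its costume certificate -/

/-- A polynomially bounded proof system for `TAUT` is optimal (so `OptimalFor V ∨ ¬ IsPolyBounded V` holds for
every `V`: the two halves of the split are never both refutable, and `¬ OptimalFor V → ¬ IsPolyBounded V`).
[cite: KrajicekProofComplexity2019, §21.1 (before Cor. 21.1.3)] [cite: CookReckhow1979, §1] -/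
theorem optimalFor_of_isPolyBounded {V : List Bool → List Bool → Bool} (hV : IsProofSystemFor V TAUT)
    (hpb : IsPolyBounded V) : OptimalFor V := by
  obtain ⟨p, hp⟩ := hpb
  intro W hW
  refine ⟨p, fun x π hπ => ?_⟩
  obtain ⟨π₀, hπ₀⟩ := (hV.mem_iff x).1 (hW.mem_of_eq_true hπ)
  obtain ⟨π', hlen, hπ'⟩ := hp x π₀ hπ₀
  exact ⟨π', hlen.trans (TM2Iter.eval_mono p (Nat.le_add_right _ _)), hπ'⟩

/-- The disjunction form. [cite: KrajicekProofComplexity2019, §21.1] -/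
theorem optimalFor_or_not_isPolyBounded {V : List Bool → List Bool → Bool} (hV : IsProofSystemFor V TAUT) :
    OptimalFor V ∨ ¬ IsPolyBounded V := by
  by_cases h : IsPolyBounded V
  · exact Or.inl (optimalFor_of_isPolyBounded hV h)
  · exact Or.inr h

/-- **The optimality split, glue PROVED for every instance.** For ANY proof system `V` for `TAUT`:
`OptimalFor V ∧ ¬ IsPolyBounded V → Target` (a p-bounded system would be simulated by `V`, making `V` p-bounded;
`IsPolyBounded.of_simulates`, tree). The two hypotheses are the two leaves; neither is known to imply `NP ≠ coNP`
for `V = EF` (census §Decomposition). [cite: KrajicekProofComplexity2019, §1.5 (p. 46) and §21.1] -/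
theorem target_of_optimalFor_of_not_isPolyBounded {V : List Bool → List Bool → Bool}
    (hV : IsProofSystemFor V TAUT) (hopt : OptimalFor V) (hlb : ¬ IsPolyBounded V) : Target := by
  refine latticeMagicTarget_iff_noPolyBoundedProofSystem.mpr fun hX => hlb ?_
  obtain ⟨W, hW, hWpb⟩ := hX
  exact IsPolyBounded.of_simulates_holds (hopt W hW) hWpb hV hW

/-- **Costume certificate.** With the proof system left universally quantified the split is the crux reworded:
`Target ↔ ∀ V, pps V → OptimalFor V → ¬ IsPolyBounded V`. Only an INSTANCE (a named `V`) is a decomposition.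
[cite: KrajicekProofComplexity2019, §1.5 (p. 46)] -/
theorem target_iff_forall_optimalFor_imp_not_isPolyBounded :
    Target ↔ ∀ V, IsProofSystemFor V TAUT → OptimalFor V → ¬ IsPolyBounded V := by
  constructor
  · intro hT V hV _ hpb
    exact latticeMagicTarget_iff_noPolyBoundedProofSystem.mp hT ⟨V, hV, hpb⟩
  · intro h
    refine latticeMagicTarget_iff_noPolyBoundedProofSystem.mpr fun hX => ?_
    obtain ⟨V, hV, hpb⟩ := hX
    exact h V hV (optimalFor_of_isPolyBounded hV hpb) hpb

/-- The lower-bound half alone, quantified over ALL proof systems, is again the crux (Cook–Reckhow). [cite: CookReckhow1979, §1 Prop. 1.1] -/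
theorem target_iff_forall_not_isPolyBounded :
    Target ↔ ∀ V, IsProofSystemFor V TAUT → ¬ IsPolyBounded V := by
  rw [target_iff_noPolyBoundedProofSystem, HasPolyBoundedProofSystem]
  push Not
  rfl

/-! ## §N Negation: the counterexample exists at `√n`; the typed obstruction below it is a CLASS statement -/

/-- The negation of the crux is `NP = coNP`; building "the counterexample" means a p-bounded certificate system
for far-from-the-lattice at EVERY constant factor. [folklore] -/
theorem not_target_iff : ¬ Target ↔ ∀ c : ℝ, 1 ≤ c → gapCVPPromise (fun _ => c) ∈ PromiseCoNP :=
  not_target_iff_forall_mem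

/-- The counterexample at factor `C√n` EXISTS (Aharonov–Regev 2005 Thm. 1.1, tree): the factor ladder is refuted
from `√n` up. [cite: AharonovRegev2005, Thm. 1.1] -/
theorem not_targetAt_sqrt : ∃ C : ℝ, 0 < C ∧ ¬ TargetAt (fun n => C * Real.sqrt n) := by
  obtain ⟨C, hC, hmem⟩ := gapCVP_sqrt_mem_promiseCoNP_holds
  exact ⟨C, hC, fun h => h hmem⟩

/-- The obstruction met when pushing the counterexample below `√n` is TYPED and PROVED in the route: every
order-`K` Taylor-minorant certificate is blind unless the dual lattice has a vector shorter than `2√(Kn)/r`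
(stmt-PneNP-2329). It is a statement about ONE certificate class; by the meta-fact below it composes to the
crux only next to a stub that is itself `≥ NP ≠ coNP`. [cite: AharonovRegev2005, §6] [cite: arXiv:2211.11693, Thm. 1.2] -/
theorem obstruction_is_a_class_statement : TaylorMinorantsBuySqrtK :=
  taylorMinorantsBuySqrtK_proof

/-- Meta-fact (tree, p101056): whatever conjunction of stubs `D` a line composes into the crux, `D` proves
`NP ≠ coNP`. [folklore] -/
theorem any_line_proves_NP_ne_coNP {D : Prop} (hline : D → Target) (hD : D) : NP ≠ coNP :=
  latticeMagicTarget_line_closure_proves_NP_ne_coNP hline hD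

end Summit.PneNP.PneNP.Cruxes.Target.StrategyCensus
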